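import Summits.ValiantsHypothesis.ValiantsHypothesis.Theses.BarrierLever
import Literature.Computability.AlgebraicComplexity.ArithCircuitProofs

/-!
# Route BarrierLever — item 19905 `BoxTransferFailsBelowDegree` (coefficient axis of the V4 door)

Item `stmt-ValiantsHypothesis-19905` (support, rank 9; planner p2-g7, cell valiant-natproofs, rung V4;
bears_on crux stmt-ValiantsHypothesis-14610 = FSV Question 6 — it neither restates nor weakens the crux;
it SUPERSEDES the dropped item `NoBoxTransferBelowLevel` stmt-20032 by removing its Q6 antecedent).
ALL-D BOX TRANSFER FAILS BELOW THE DEGREE: for all `n, a, b, h` with `4h + 2 ≤ N^a` (`N = C(2n,n)`)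
there is a level-`a` distinguisher `D` (size `≤ N^a`, degree `≤ N^a`) vanishing at EVERY polynomial
whose coefficients are integers of modulus `≤ h`, and nonzero at some member of `SmallCircuits ℂ n b`.

**Proof** (planner p2-g7's witness, re-derived here against the tree's complexity lemmas
`Literature.Computability.AlgebraicComplexity.{complexity_finset_prod_le, complexity_add_le_holds,
complexity_X_holds, complexity_C_holds}` because the attached scratch `CoeffAxis2-p2g7.lean` is not
readable from a prover jail): `D = ∏_{s = -h}^{h} (c₀ - s)`, `c₀` the coefficient variable of the
constant monomial — fan-in-two size `≤ (2h+1) + (2h+1) = 4h + 2 ≤ N^a`, degree `≤ 2h + 1 ≤ N^a`; it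
vanishes at every integer-box-`h` polynomial (its constant coefficient is an integer in `[-h, h]`, so
one factor vanishes); the non-root is the constant polynomial `h + 1` (degree `0`, complexity `0`, so
in `SmallCircuits ℂ n b` for every `b`), where every factor `h + 1 - s`, `s ≤ h`, is nonzero.

READING (planner): the plain transfer property «every level-`a` `D` vanishing on the integer box of
height `h` vanishes on `SmallCircuits ℂ n b`» is FALSE for every box height `h` below `(N^a - 2)/4`,
unconditionally — the coefficient-axis door needs box heights above the degree (companions: items
20033/20037 transfer at height `N^{(a+1)(2n+1)}`, item 19906 largeness above the degree).

WHAT THIS IS NOT: nothing on FSV Question 6 / crux stmt-ValiantsHypothesis-14610 or on VP vs VNP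
(VP ≠ VNP is NOT proved; this is an unconditional triviality on the coefficient axis of the door).
-/

-- layout Summits/ValiantsHypothesis/ValiantsHypothesis forces the duplicated namespace component
set_option linter.dupNamespace false

namespace Summit.ValiantsHypothesis.ValiantsHypothesis.Theorems.BarrierLever.CoeffAxis

open MvPolynomial Literature.Barriers.ValiantsHypothesis Literature.Computability.AlgebraicComplexity

/-- Each factor `c₀ - s` of the box annihilator has fan-in-two complexity `≤ 1`
(`L(X) = L(C) = 0`, one addition gate). -/
theorem complexity_X_sub_C_le {σ : Type*} (i : σ) (c : ℂ) :
    complexity (X i - C c : MvPolynomial σ ℂ) ≤ 1 := by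
  have h : (X i - C c : MvPolynomial σ ℂ) = X i + C (-c) := by
    rw [map_neg, sub_eq_add_neg]
  rw [h]
  calc complexity (X i + C (-c) : MvPolynomial σ ℂ)
      ≤ complexity (X i : MvPolynomial σ ℂ) + complexity (C (-c) : MvPolynomial σ ℂ) + 1 :=
        complexity_add_le_holds _ _
    _ = 1 := by rw [complexity_X_holds, complexity_C_holds]

/-- Each factor `c₀ - s` has total degree `≤ 1`. -/
theorem totalDegree_X_sub_C_le {σ : Type*} (i : σ) (c : ℂ) :
    (X i - C c : MvPolynomial σ ℂ).totalDegree ≤ 1 :=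
  (totalDegree_sub_C_le _ _).trans (totalDegree_X (R := ℂ) i).le

/-- The box annihilator `∏_{s=-h}^{h} (c_i - s)` has fan-in-two complexity `≤ 4h + 2`. -/
theorem complexity_boxProd_le {σ : Type*} (i : σ) (h : ℕ) :
    complexity (∏ s ∈ Finset.Icc (-(h : ℤ)) h, (X i - C (s : ℂ) : MvPolynomial σ ℂ)) ≤ 4 * h + 2 := by
  have hcard : (Finset.Icc (-(h : ℤ)) h).card = 2 * h + 1 := by
    rw [Int.card_Icc]; omega
  calc complexity (∏ s ∈ Finset.Icc (-(h : ℤ)) h, (X i - C (s : ℂ) : MvPolynomial σ ℂ))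
      ≤ ∑ s ∈ Finset.Icc (-(h : ℤ)) h, complexity (X i - C (s : ℂ) : MvPolynomial σ ℂ)
          + (Finset.Icc (-(h : ℤ)) h).card := complexity_finset_prod_le _ _
    _ ≤ (Finset.Icc (-(h : ℤ)) h).card • 1 + (Finset.Icc (-(h : ℤ)) h).card := by
        gcongr
        exact Finset.sum_le_card_nsmul _ _ _ fun s _ => complexity_X_sub_C_le i (s : ℂ)
    _ = 4 * h + 2 := by rw [hcard, smul_eq_mul]; ring

/-- The box annihilator has total degree `≤ 2h + 1`. -/
theorem totalDegree_boxProd_le {σ : Type*} (i : σ) (h : ℕ) :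
    (∏ s ∈ Finset.Icc (-(h : ℤ)) h, (X i - C (s : ℂ) : MvPolynomial σ ℂ)).totalDegree ≤ 2 * h + 1 := by
  have hcard : (Finset.Icc (-(h : ℤ)) h).card = 2 * h + 1 := by
    rw [Int.card_Icc]; omega
  calc (∏ s ∈ Finset.Icc (-(h : ℤ)) h, (X i - C (s : ℂ) : MvPolynomial σ ℂ)).totalDegree
      ≤ ∑ s ∈ Finset.Icc (-(h : ℤ)) h, (X i - C (s : ℂ) : MvPolynomial σ ℂ).totalDegree :=
        totalDegree_finsetProd _ _
    _ ≤ (Finset.Icc (-(h : ℤ)) h).card • 1 :=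
        Finset.sum_le_card_nsmul _ _ _ fun s _ => totalDegree_X_sub_C_le i (s : ℂ)
    _ = 2 * h + 1 := by rw [hcard, smul_eq_mul, mul_one]

/-- Evaluation of the box annihilator: `∏_{s=-h}^{h} (x_i - s)`. -/
theorem eval_boxProd {σ : Type*} (i : σ) (h : ℕ) (x : σ → ℂ) :
    eval x (∏ s ∈ Finset.Icc (-(h : ℤ)) h, (X i - C (s : ℂ) : MvPolynomial σ ℂ)) =
      ∏ s ∈ Finset.Icc (-(h : ℤ)) h, (x i - (s : ℂ)) := by
  rw [map_prod]
  refine Finset.prod_congr rfl fun s _ => ?_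
  rw [map_sub, eval_X, eval_C]

/-- **Item 19905 `BoxTransferFailsBelowDegree`** (the route decl, by name). -/
theorem boxTransferFailsBelowDegree : Theses.BarrierLever.BoxTransferFailsBelowDegree := by
  classical
  intro n a b h hh
  -- the coordinate of the constant monomial (degree `0 ≤ n`; membership as in the tree's
  -- `…BarrierLever.NaturalProofsSeparateVNP.zero_mem_degLEMonomials`, inlined to keep imports light)
  set m₀ : degLEMonomials n := ⟨0, by simp [degLEMonomials]⟩ with hm₀
  refine ⟨∏ s ∈ Finset.Icc (-(h : ℤ)) h, (X m₀ - C (s : ℂ)), ⟨?_, ?_⟩, ?_, ?_⟩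
  · -- size ≤ 4h + 2 ≤ N^a
    exact (complexity_boxProd_le m₀ h).trans hh
  · -- degree ≤ 2h + 1 ≤ N^a
    exact (totalDegree_boxProd_le m₀ h).trans (by omega)
  · -- vanishing on the integer box of height h: the constant coefficient is a root
    intro f hf
    obtain ⟨z, hz, hzh⟩ := hf 0
    rw [eval_boxProd]
    refine Finset.prod_eq_zero (i := z) (Finset.mem_Icc.mpr (abs_le.mp hzh)) ?_
    rw [coeffVector_apply, hm₀]
    change coeff 0 f - (z : ℂ) = 0
    rw [hz, sub_self]
  · -- the non-root: the constant polynomial h + 1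
    refine ⟨C ((h : ℂ) + 1), ⟨?_, ?_⟩, ?_⟩
    · rw [totalDegree_C]; exact Nat.zero_le _
    · rw [complexity_C_holds]; exact Nat.zero_le _
    · rw [eval_boxProd, Finset.prod_ne_zero_iff]
      intro s hs
      rw [coeffVector_apply, hm₀]
      change coeff 0 (C ((h : ℂ) + 1)) - (s : ℂ) ≠ 0
      rw [coeff_zero_C, sub_ne_zero]
      have hs' : s ≤ (h : ℤ) := (Finset.mem_Icc.mp hs).2
      have hne : ((h : ℤ) + 1 : ℤ) ≠ s := by omega
      have hcast : ((h : ℂ) + 1) = (((h : ℤ) + 1 : ℤ) : ℂ) := by push_cast; ring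
      rw [hcast]
      exact fun heq => hne (Int.cast_injective heq)

end Summit.ValiantsHypothesis.ValiantsHypothesis.Theorems.BarrierLever.CoeffAxis
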